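import Mathlib.Analysis.SpecialFunctions.Integrals.Basic
import Mathlib.Analysis.SpecialFunctions.Integrability.Basic
import Mathlib.MeasureTheory.Integral.Bochner.Set
import HarnessLib

/-!
# Comparison principle for Leray's Volterra inequality
# `V(t) ≤ a(t) + C ∫₀ᵗ (t - s)^{-1/2} V(s)² ds`

Analysis/FluidPDE support file (pure real analysis) for the discharge of the named fact
`Literature.Analysis.FluidPDE.leray_supnorm_le_of_Lp` (`NSLerayBlowupRateLp.lean`; Leray 1934,
§21; Ożański–Pooley 2018, Lemma 6.23 (iii)), whose printed proof is "the theory of integral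
inequalities" applied to the sup-norm inequality
`‖u(t)‖_∞ ≤ C' ∫₀ᵗ ‖u(s)‖²_∞ (t-s)^{-1/2} ds + C' ‖u₀‖_p t^{-3/2p}` (Ożański–Pooley 2018, (6.65);
Leray 1934, (3.5)) with the supersolution `ψ(t) = C ‖u₀‖_p t^{-3/2p}`.

* `volterra_sqrt_comparison` — the comparison principle (Ożański–Pooley 2018, Lemma 6.5 =
  Lemma 6.48, whose Step 1 is exactly the argument below; Leray 1934, §21, (3.14)–(3.15)): if a
  bounded measurable `V ≥ 0` satisfies `V(t) ≤ a(t) + C ∫₀ᵗ (t-s)^{-1/2} V(s)² ds` on `(0, t₁]`, a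
  continuous `ψ` is a **strict** supersolution in the form
  `a(t) + C ∫₀ᵗ (t-s)^{-1/2} ψ(s)² ds ≤ G(t) < ψ(t)` with `G` continuous, and `V ≤ ψ` on some
  initial segment `(0, δ]`, then `V ≤ ψ` on `(0, t₁]`. No continuity of `V` is needed (as
  Ożański–Pooley remark), only boundedness: at the infimum `t⋆` of the bad set, the part of the
  memory integral over `[t⋆, t)` is `O(√(t - t⋆))`.
* `setIntegral_abel_rpow_le` — the Abel–Beta bound
  `∫₀ᵗ (t-s)^{-1/2} s^{-β} ds ≤ 2(2 + 1/(1-β)) t^{1/2-β}` (`0 ≤ β < 1`; split at `t/2`), with the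
  integrability of the integrand, which makes `ψ(t) = K t^{-β/2}` an explicit supersolution.

Everything here is proved; Mathlib has the ingredients (`integral_rpow`,
`intervalIntegral.intervalIntegrable_rpow'`, `IntervalIntegrable.comp_sub_left`,
`MeasureTheory.setIntegral_union`, `exists_lt_of_csInf_lt`) but no Volterra/Abel comparison
lemma (`lean search 'Volterra|Abel kernel|Gronwall'`: only `Mathlib.Analysis.ODE.Gronwall`, the
differential form with a Lipschitz right-hand side, which does not cover the weakly singular
memory term).

## References

* W. S. Ożański, B. C. Pooley, *Leray's fundamental work on the Navier–Stokes equations: a modern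
  review*, in: Partial Differential Equations in Fluid Mechanics, LMS Lecture Note Ser. 452, CUP
  2018: Lemma 6.5 (p. 123), Lemma 6.48 and its proof, Step 1 (Appendix 6.5.5, p. 175),
  (6.65) and Lemma 6.23 (p. 144). [OzanskiPooley2018]
* J. Leray, *Sur le mouvement d'un liquide visqueux emplissant l'espace*, Acta Math. 63 (1934),
  §21, (3.5), (3.14)–(3.15). [Leray1934]
-/

noncomputable section

open MeasureTheory Set Filter Topology

namespace Literature.Analysis.FluidPDE

/-! ### The Abel kernel `s ↦ (t - s)^{-1/2}` and the weights `s ↦ s^{-β}` -/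

/-- Measurability of `s ↦ (t - s) ^ r`. [folklore] -/
theorem measurable_sub_rpow_const (t r : ℝ) : Measurable fun s : ℝ => (t - s) ^ r :=
  (measurable_const.sub measurable_id).pow_const r

/-- `s ↦ (t - s)^r` is integrable on `(a, t)` for `-1 < r` (reflection of
`intervalIntegral.intervalIntegrable_rpow'`). [folklore] -/
theorem integrableOn_sub_rpow_Ioo {a t r : ℝ} (hr : -1 < r) :
    IntegrableOn (fun s : ℝ => (t - s) ^ r) (Ioo a t) := by
  rcases le_or_gt t a with hta | hat
  · rw [Ioo_eq_empty (not_lt.2 hta)]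
    exact integrableOn_empty
  have h := (intervalIntegral.intervalIntegrable_rpow' hr (a := 0) (b := t - a)).comp_sub_left t
  rw [sub_zero, sub_sub_cancel] at h
  have h' := (h.symm)
  rw [intervalIntegrable_iff_integrableOn_Ioc_of_le hat.le] at h'
  exact h'.mono_set Ioo_subset_Ioc_self

/-- `s ↦ s^r` is integrable on `(a, b)` for `-1 < r`. [folklore] -/
theorem integrableOn_rpow_Ioo {a b r : ℝ} (hr : -1 < r) :
    IntegrableOn (fun s : ℝ => s ^ r) (Ioo a b) := by
  rcases le_or_gt b a with hba | hab
  · rw [Ioo_eq_empty (not_lt.2 hba)]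
    exact integrableOn_empty
  have h := intervalIntegral.intervalIntegrable_rpow' hr (a := a) (b := b)
  rw [intervalIntegrable_iff_integrableOn_Ioc_of_le hab.le] at h
  exact h.mono_set Ioo_subset_Ioc_self

/-- `∫_{(a,t)} (t - s)^{-1/2} ds = 2 (t - a)^{1/2}` for `a ≤ t`. [folklore] -/
theorem setIntegral_Ioo_sub_rpow_neg_half {a t : ℝ} (hat : a ≤ t) :
    ∫ s in Ioo a t, (t - s) ^ (-(1 / 2 : ℝ)) = 2 * (t - a) ^ (1 / 2 : ℝ) := by
  rw [← integral_Ioc_eq_integral_Ioo, ← intervalIntegral.integral_of_le hat,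
    intervalIntegral.integral_comp_sub_left (fun s : ℝ => s ^ (-(1 / 2 : ℝ))) t, sub_self,
    integral_rpow (Or.inl (by norm_num))]
  have h1 : (-(1 / 2 : ℝ)) + 1 = 1 / 2 := by norm_num
  rw [h1, Real.zero_rpow (by norm_num), sub_zero]
  ring

/-- `∫_{(0,b)} s^{-β} ds = b^{1-β}/(1-β)` for `0 ≤ b`, `β < 1`. [folklore] -/
theorem setIntegral_Ioo_rpow_neg {b β : ℝ} (hb : 0 ≤ b) (hβ : β < 1) :
    ∫ s in Ioo 0 b, s ^ (-β) = b ^ (1 - β) / (1 - β) := by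
  rw [← integral_Ioc_eq_integral_Ioo, ← intervalIntegral.integral_of_le hb,
    integral_rpow (Or.inl (by linarith))]
  have h1 : -β + 1 = 1 - β := by ring
  rw [h1, Real.zero_rpow (by linarith), sub_zero]

/-- **The Abel–Beta bound.** For `0 ≤ β < 1` and `0 < t`,
`∫_{(0,t)} (t - s)^{-1/2} s^{-β} ds ≤ 2 (2 + 1/(1-β)) t^{1/2-β}`, and the integrand is integrable on
`(0, t)` (split at `t/2`: on `(0, t/2]` the kernel is at most `(t/2)^{-1/2}`, on `(t/2, t)` the
weight is at most `(t/2)^{-β}`). The exact value is `B(1/2, 1-β) t^{1/2-β}`; only the order is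
needed. [folklore] -/
theorem setIntegral_abel_rpow_le {β t : ℝ} (hβ0 : 0 ≤ β) (hβ : β < 1) (ht : 0 < t) :
    IntegrableOn (fun s : ℝ => (t - s) ^ (-(1 / 2 : ℝ)) * s ^ (-β)) (Ioo 0 t) ∧
      ∫ s in Ioo 0 t, (t - s) ^ (-(1 / 2 : ℝ)) * s ^ (-β) ≤
        2 * (2 + 1 / (1 - β)) * t ^ (1 / 2 - β) := by
  have ht2 : 0 < t / 2 := by positivity
  have h1β : 0 < 1 - β := by linarith
  -- the two pieces
  set I₁ : Set ℝ := Ioc 0 (t / 2) with hI₁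
  set I₂ : Set ℝ := Ioo (t / 2) t with hI₂
  have hunion : I₁ ∪ I₂ = Ioo 0 t := Ioc_union_Ioo_eq_Ioo ht2.le (by linarith)
  have hdisj : Disjoint I₁ I₂ := by
    rw [hI₁, hI₂, Set.disjoint_left]
    intro s hs hs'
    exact absurd hs'.1 (not_lt.2 hs.2)
  set f : ℝ → ℝ := fun s => (t - s) ^ (-(1 / 2 : ℝ)) * s ^ (-β) with hf
  have hmk : Measurable fun s : ℝ => (t - s) ^ (-(1 / 2 : ℝ)) := measurable_sub_rpow_const t _
  have hmw : Measurable fun s : ℝ => s ^ (-β) := measurable_id.pow_const _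
  -- piece 1: kernel bounded by `(t/2)^{-1/2}`, weight integrable
  have hk1 : ∀ s ∈ I₁, (t - s) ^ (-(1 / 2 : ℝ)) ≤ (t / 2) ^ (-(1 / 2 : ℝ)) := fun s hs =>
    Real.rpow_le_rpow_of_nonpos ht2 (by linarith [hs.2]) (by norm_num)
  have hk1' : ∀ s ∈ I₁, 0 ≤ (t - s) ^ (-(1 / 2 : ℝ)) := fun s hs =>
    Real.rpow_nonneg (by linarith [hs.2]) _
  have hw1 : IntegrableOn (fun s : ℝ => s ^ (-β)) I₁ := by
    have h := intervalIntegral.intervalIntegrable_rpow' (show -1 < -β by linarith) (a := 0) (b := t / 2)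
    rwa [intervalIntegrable_iff_integrableOn_Ioc_of_le ht2.le] at h
  have hint1 : IntegrableOn f I₁ := by
    refine Integrable.bdd_mul (c := (t / 2) ^ (-(1 / 2 : ℝ))) hw1 hmk.aestronglyMeasurable ?_
    refine (ae_restrict_iff' measurableSet_Ioc).2 (Eventually.of_forall fun s hs => ?_)
    rw [Real.norm_of_nonneg (hk1' s hs)]
    exact hk1 s hs
  -- piece 2: weight bounded by `(t/2)^{-β}`, kernel integrable
  have hw2 : ∀ s ∈ I₂, s ^ (-β) ≤ (t / 2) ^ (-β) := fun s hs =>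
    Real.rpow_le_rpow_of_nonpos ht2 hs.1.le (by linarith)
  have hw2' : ∀ s ∈ I₂, 0 ≤ s ^ (-β) := fun s hs => Real.rpow_nonneg (ht2.trans hs.1).le _
  have hk2 : IntegrableOn (fun s : ℝ => (t - s) ^ (-(1 / 2 : ℝ))) I₂ :=
    integrableOn_sub_rpow_Ioo (by norm_num)
  have hint2 : IntegrableOn f I₂ := by
    refine Integrable.mul_bdd (c := (t / 2) ^ (-β)) hk2 hmw.aestronglyMeasurable ?_
    refine (ae_restrict_iff' measurableSet_Ioo).2 (Eventually.of_forall fun s hs => ?_)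
    rw [Real.norm_of_nonneg (hw2' s hs)]
    exact hw2 s hs
  have hint : IntegrableOn f (Ioo 0 t) := by
    rw [← hunion]
    exact hint1.union hint2
  refine ⟨hint, ?_⟩
  -- the estimate
  have hsplit : ∫ s in Ioo 0 t, f s = (∫ s in I₁, f s) + ∫ s in I₂, f s := by
    rw [← hunion]
    exact setIntegral_union hdisj measurableSet_Ioo hint1 hint2
  have hb1 : ∫ s in I₁, f s ≤ (t / 2) ^ (-(1 / 2 : ℝ)) * ((t / 2) ^ (1 - β) / (1 - β)) := by
    calc ∫ s in I₁, f s ≤ ∫ s in I₁, (t / 2) ^ (-(1 / 2 : ℝ)) * s ^ (-β) := by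
          refine setIntegral_mono_on hint1 (hw1.const_mul _) measurableSet_Ioc fun s hs => ?_
          exact mul_le_mul_of_nonneg_right (hk1 s hs) (Real.rpow_nonneg hs.1.le _)
      _ = (t / 2) ^ (-(1 / 2 : ℝ)) * ((t / 2) ^ (1 - β) / (1 - β)) := by
          rw [integral_const_mul, hI₁, integral_Ioc_eq_integral_Ioo,
            setIntegral_Ioo_rpow_neg ht2.le hβ]
  have hb2 : ∫ s in I₂, f s ≤ (t / 2) ^ (-β) * (2 * (t - t / 2) ^ (1 / 2 : ℝ)) := by
    calc ∫ s in I₂, f s ≤ ∫ s in I₂, (t / 2) ^ (-β) * (t - s) ^ (-(1 / 2 : ℝ)) := by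
          refine setIntegral_mono_on hint2 (hk2.const_mul _) measurableSet_Ioo fun s hs => ?_
          rw [hf]
          dsimp only
          rw [mul_comm]
          exact mul_le_mul_of_nonneg_right (hw2 s hs) (Real.rpow_nonneg (by linarith [hs.2]) _)
      _ = (t / 2) ^ (-β) * (2 * (t - t / 2) ^ (1 / 2 : ℝ)) := by
          rw [integral_const_mul, hI₂, setIntegral_Ioo_sub_rpow_neg_half (by linarith)]
  -- simplify the two bounds to multiples of `(t/2)^{1/2-β}`
  have e1 : (t / 2) ^ (-(1 / 2 : ℝ)) * ((t / 2) ^ (1 - β) / (1 - β)) =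
      (1 / (1 - β)) * (t / 2) ^ (1 / 2 - β) := by
    rw [mul_div_assoc', ← Real.rpow_add ht2]
    have : -(1 / 2 : ℝ) + (1 - β) = 1 / 2 - β := by ring
    rw [this]
    ring
  have e2 : (t / 2) ^ (-β) * (2 * (t - t / 2) ^ (1 / 2 : ℝ)) = 2 * (t / 2) ^ (1 / 2 - β) := by
    have : t - t / 2 = t / 2 := by ring
    rw [this, mul_left_comm, ← Real.rpow_add ht2]
    have : -β + 1 / 2 = 1 / 2 - β := by ring
    rw [this]
  have hhalf : (t / 2) ^ (1 / 2 - β) ≤ 2 * t ^ (1 / 2 - β) := by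
    rw [Real.div_rpow ht.le zero_le_two]
    rw [div_le_iff₀ (Real.rpow_pos_of_pos two_pos _)]
    have h2 : (2 : ℝ) ^ (-1 : ℝ) ≤ 2 ^ (1 / 2 - β) :=
      Real.rpow_le_rpow_of_exponent_le one_le_two (by linarith)
    rw [Real.rpow_neg_one] at h2
    have h3 : 0 ≤ t ^ (1 / 2 - β) := Real.rpow_nonneg ht.le _
    have h4 : (0 : ℝ) ≤ 2 * 2 ^ (1 / 2 - β) - 1 := by
      have : (2 : ℝ)⁻¹ = 1 / 2 := by norm_num
      linarith
    nlinarith [mul_nonneg h3 h4]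
  have hpos : 0 ≤ (t / 2) ^ (1 / 2 - β) := Real.rpow_nonneg ht2.le _
  calc ∫ s in Ioo 0 t, f s = (∫ s in I₁, f s) + ∫ s in I₂, f s := hsplit
    _ ≤ (1 / (1 - β)) * (t / 2) ^ (1 / 2 - β) + 2 * (t / 2) ^ (1 / 2 - β) := by
        rw [← e1, ← e2]; exact add_le_add hb1 hb2
    _ = (2 + 1 / (1 - β)) * (t / 2) ^ (1 / 2 - β) := by ring
    _ ≤ (2 + 1 / (1 - β)) * (2 * t ^ (1 / 2 - β)) :=
        mul_le_mul_of_nonneg_left hhalf (by positivity)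
    _ = 2 * (2 + 1 / (1 - β)) * t ^ (1 / 2 - β) := by ring

/-! ### The comparison principle -/

/-- **Comparison principle for the Volterra inequality with the Abel kernel**
(Ożański–Pooley 2018, Lemma 6.5 / Lemma 6.48, Step 1 of its proof; Leray 1934, §21,
(3.14)–(3.15): "supposons qu'une fonction `φ(t)` … vérifie … `φ(t) ≥ A' ∫₀ᵗ φ²(t') dt'/√(ν(t-t'))
+ …`; nous avons alors `V(t) ≤ φ(t - t₀)`"). Let `C ≥ 0`, `0 < δ`, and on `(0, t₁]` let
`V` be measurable with `0 ≤ V ≤ M` and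
`V(t) ≤ a(t) + C ∫_{(0,t)} (t - s)^{-1/2} V(s)² ds`; let `ψ` and `G` be continuous on
`(0, t₁]` with `a(t) + C ∫_{(0,t)} (t - s)^{-1/2} ψ(s)² ds ≤ G(t) < ψ(t)` (a strict
supersolution), the integrands `(t - s)^{-1/2} ψ(s)²` being integrable on `(0, t)`; and let
`V ≤ ψ` on `(0, δ]`. Then `V ≤ ψ` on `(0, t₁]`. Proof: if the bad set
`B = {t ∈ (0, t₁] : ψ(t) < V(t)}` is nonempty, let `t⋆ = inf B ≥ δ`; on `(0, t⋆)` we have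
`V ≤ ψ`, so for `t ∈ B`, splitting the memory integral at `t⋆` and using `V ≤ M` on `[t⋆, t)`,
`V(t) ≤ G(t) + 2 C M² √(t - t⋆)`; by continuity of `G < ψ` at `t⋆` this is `< ψ(t)` for
`t ∈ B` close to `t⋆` — a contradiction. No continuity of `V` is used. [cite: OzanskiPooley2018, Lemma 6.48 (proof, Step 1), Lemma 6.5] -/
theorem volterra_sqrt_comparison {V ψ G a : ℝ → ℝ} {C M t₁ δ : ℝ} (hC : 0 ≤ C) (hδ : 0 < δ)
    (hVm : Measurable V) (hV0 : ∀ t ∈ Ioc 0 t₁, 0 ≤ V t) (hVM : ∀ t ∈ Ioc 0 t₁, V t ≤ M)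
    (hV : ∀ t ∈ Ioc 0 t₁, V t ≤ a t + C * ∫ s in Ioo 0 t, (t - s) ^ (-(1 / 2 : ℝ)) * V s ^ 2)
    (hψG : ∀ t ∈ Ioc 0 t₁, a t + C * ∫ s in Ioo 0 t, (t - s) ^ (-(1 / 2 : ℝ)) * ψ s ^ 2 ≤ G t)
    (hGψ : ∀ t ∈ Ioc 0 t₁, G t < ψ t) (hGc : ContinuousOn G (Ioc 0 t₁))
    (hψc : ContinuousOn ψ (Ioc 0 t₁))
    (hψi : ∀ t ∈ Ioc 0 t₁, IntegrableOn (fun s => (t - s) ^ (-(1 / 2 : ℝ)) * ψ s ^ 2) (Ioo 0 t))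
    (hinit : ∀ t ∈ Ioc 0 δ, V t ≤ ψ t) :
    ∀ t ∈ Ioc 0 t₁, V t ≤ ψ t := by
  by_contra hbad
  push Not at hbad
  -- the bad set and its infimum
  set B : Set ℝ := {t | t ∈ Ioc 0 t₁ ∧ ψ t < V t} with hB
  have hBne : B.Nonempty := by
    obtain ⟨t, ht, hlt⟩ := hbad
    exact ⟨t, ht, hlt⟩
  have hBδ : ∀ t ∈ B, δ < t := by
    intro t ht
    by_contra hle
    exact absurd (hinit t ⟨ht.1.1, not_lt.1 hle⟩) (not_le.2 ht.2)
  have hBbdd : BddBelow B := ⟨δ, fun t ht => (hBδ t ht).le⟩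
  set tstar : ℝ := sInf B with htstar
  have hδt : δ ≤ tstar := le_csInf hBne fun t ht => (hBδ t ht).le
  have htpos : 0 < tstar := hδ.trans_le hδt
  obtain ⟨b₀, hb₀⟩ := hBne
  have htt₁ : tstar ≤ t₁ := (csInf_le hBbdd hb₀).trans hb₀.1.2
  have htI : tstar ∈ Ioc 0 t₁ := ⟨htpos, htt₁⟩
  -- below `tstar` the comparison holds
  have hgood : ∀ s ∈ Ioo 0 tstar, V s ≤ ψ s := by
    intro s hs
    by_contra hlt
    have hsB : s ∈ B := ⟨⟨hs.1, hs.2.le.trans htt₁⟩, not_le.1 hlt⟩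
    exact absurd (csInf_le hBbdd hsB) (not_le.2 hs.2)
  have hM0 : 0 ≤ M := (hV0 tstar htI).trans (hVM tstar htI)
  -- ### the key estimate on the bad set: `V t ≤ G t + C M² 2 √(t - tstar)`
  have hkey : ∀ t ∈ B, V t ≤ G t + C * (M ^ 2 * (2 * (t - tstar) ^ (1 / 2 : ℝ))) := by
    intro t ht
    have htI' : t ∈ Ioc 0 t₁ := ht.1
    have hst : tstar ≤ t := csInf_le hBbdd ht
    have ht0 : 0 < t := htI'.1
    -- integrability of the two memory integrands on `(0, t)`
    have hk : IntegrableOn (fun s : ℝ => (t - s) ^ (-(1 / 2 : ℝ))) (Ioo 0 t) :=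
      integrableOn_sub_rpow_Ioo (by norm_num)
    have hkV : IntegrableOn (fun s => (t - s) ^ (-(1 / 2 : ℝ)) * V s ^ 2) (Ioo 0 t) := by
      refine Integrable.mul_bdd (c := M ^ 2) hk ((hVm.pow_const 2).aestronglyMeasurable) ?_
      refine (ae_restrict_iff' measurableSet_Ioo).2 (Eventually.of_forall fun s hs => ?_)
      have hsI : s ∈ Ioc 0 t₁ := ⟨hs.1, hs.2.le.trans htI'.2⟩
      rw [Real.norm_of_nonneg (sq_nonneg _)]
      exact pow_le_pow_left₀ (hV0 s hsI) (hVM s hsI) 2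
    have hkψ := hψi t htI'
    -- split `(0, t) = (0, tstar) ∪ [tstar, t)`
    have hunion : Ioo 0 tstar ∪ Ico tstar t = Ioo 0 t := Ioo_union_Ico_eq_Ioo htpos hst
    have hdisj : Disjoint (Ioo 0 tstar) (Ico tstar t) := by
      rw [Set.disjoint_left]
      intro s hs hs'
      exact absurd hs'.1 (not_le.2 hs.2)
    have hsplit : ∫ s in Ioo 0 t, (t - s) ^ (-(1 / 2 : ℝ)) * V s ^ 2 =
        (∫ s in Ioo 0 tstar, (t - s) ^ (-(1 / 2 : ℝ)) * V s ^ 2) +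
          ∫ s in Ico tstar t, (t - s) ^ (-(1 / 2 : ℝ)) * V s ^ 2 := by
      rw [← hunion]
      exact setIntegral_union hdisj measurableSet_Ico
        (hkV.mono_set (hunion ▸ subset_union_left)) (hkV.mono_set (hunion ▸ subset_union_right))
    -- first part: `V ≤ ψ` on `(0, tstar)`
    have hsub1 : Ioo 0 tstar ⊆ Ioo 0 t := hunion ▸ subset_union_left
    have hsub2 : Ico tstar t ⊆ Ioo 0 t := hunion ▸ subset_union_right
    have h1 : ∫ s in Ioo 0 tstar, (t - s) ^ (-(1 / 2 : ℝ)) * V s ^ 2 ≤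
        ∫ s in Ioo 0 t, (t - s) ^ (-(1 / 2 : ℝ)) * ψ s ^ 2 := by
      calc ∫ s in Ioo 0 tstar, (t - s) ^ (-(1 / 2 : ℝ)) * V s ^ 2
          ≤ ∫ s in Ioo 0 tstar, (t - s) ^ (-(1 / 2 : ℝ)) * ψ s ^ 2 := by
            refine setIntegral_mono_on (hkV.mono_set hsub1) (hkψ.mono_set hsub1) measurableSet_Ioo
              fun s hs => ?_
            have hsI : s ∈ Ioc 0 t₁ := ⟨hs.1, hs.2.le.trans htt₁⟩
            exact mul_le_mul_of_nonneg_left (pow_le_pow_left₀ (hV0 s hsI) (hgood s hs) 2)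
              (Real.rpow_nonneg (by linarith [hs.2]) _)
        _ ≤ ∫ s in Ioo 0 t, (t - s) ^ (-(1 / 2 : ℝ)) * ψ s ^ 2 := by
            refine setIntegral_mono_set hkψ ?_ (Eventually.of_forall hsub1)
            refine (ae_restrict_iff' measurableSet_Ioo).2 (Eventually.of_forall fun s hs => ?_)
            exact mul_nonneg (Real.rpow_nonneg (by linarith [hs.2]) _) (sq_nonneg _)
    -- second part: `V ≤ M` on `[tstar, t)`
    have h2 : ∫ s in Ico tstar t, (t - s) ^ (-(1 / 2 : ℝ)) * V s ^ 2 ≤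
        M ^ 2 * (2 * (t - tstar) ^ (1 / 2 : ℝ)) := by
      have hkI : IntegrableOn (fun s : ℝ => (t - s) ^ (-(1 / 2 : ℝ))) (Ico tstar t) := hk.mono_set hsub2
      calc ∫ s in Ico tstar t, (t - s) ^ (-(1 / 2 : ℝ)) * V s ^ 2
          ≤ ∫ s in Ico tstar t, (t - s) ^ (-(1 / 2 : ℝ)) * M ^ 2 := by
            refine setIntegral_mono_on (hkV.mono_set hsub2) (hkI.mul_const _) measurableSet_Ico
              fun s hs => ?_
            have hsI : s ∈ Ioc 0 t₁ := ⟨htpos.trans_le hs.1, hs.2.le.trans htI'.2⟩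
            exact mul_le_mul_of_nonneg_left (pow_le_pow_left₀ (hV0 s hsI) (hVM s hsI) 2)
              (Real.rpow_nonneg (by linarith [hs.2]) _)
        _ = M ^ 2 * (2 * (t - tstar) ^ (1 / 2 : ℝ)) := by
            rw [integral_mul_const, integral_Ico_eq_integral_Ioo,
              setIntegral_Ioo_sub_rpow_neg_half hst, mul_comm]
    calc V t ≤ a t + C * ∫ s in Ioo 0 t, (t - s) ^ (-(1 / 2 : ℝ)) * V s ^ 2 := hV t htI'
      _ = a t + C * ((∫ s in Ioo 0 tstar, (t - s) ^ (-(1 / 2 : ℝ)) * V s ^ 2) +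
            ∫ s in Ico tstar t, (t - s) ^ (-(1 / 2 : ℝ)) * V s ^ 2) := by rw [hsplit]
      _ ≤ a t + C * ((∫ s in Ioo 0 t, (t - s) ^ (-(1 / 2 : ℝ)) * ψ s ^ 2) +
            M ^ 2 * (2 * (t - tstar) ^ (1 / 2 : ℝ))) := by
          gcongr
      _ = (a t + C * ∫ s in Ioo 0 t, (t - s) ^ (-(1 / 2 : ℝ)) * ψ s ^ 2) +
            C * (M ^ 2 * (2 * (t - tstar) ^ (1 / 2 : ℝ))) := by ring
      _ ≤ G t + C * (M ^ 2 * (2 * (t - tstar) ^ (1 / 2 : ℝ))) := by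
          gcongr
          exact hψG t htI'
  -- ### continuity of `G < ψ` at `tstar`
  set ε : ℝ := (ψ tstar - G tstar) / 3 with hε
  have hεpos : 0 < ε := by
    rw [hε]
    linarith [hGψ tstar htI]
  obtain ⟨η₁, hη₁, hG'⟩ := Metric.continuousWithinAt_iff.1 (hGc tstar htI) ε hεpos
  obtain ⟨η₂, hη₂, hψ'⟩ := Metric.continuousWithinAt_iff.1 (hψc tstar htI) ε hεpos
  -- the memory slack `C M² 2 √(t - tstar) < ε` for `t - tstar < η₃`
  set L : ℝ := C * (M ^ 2 * 2) + 1 with hL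
  have hLpos : 0 < L := by rw [hL]; positivity
  set η₃ : ℝ := (ε / L) ^ 2 with hη₃
  have hη₃pos : 0 < η₃ := by rw [hη₃]; positivity
  have hslack : ∀ t, tstar ≤ t → t - tstar < η₃ →
      C * (M ^ 2 * (2 * (t - tstar) ^ (1 / 2 : ℝ))) < ε := by
    intro t hst hlt
    have h0 : 0 ≤ t - tstar := sub_nonneg.2 hst
    have hroot : (t - tstar) ^ (1 / 2 : ℝ) < ε / L := by
      have h1 : (t - tstar) ^ (1 / 2 : ℝ) < η₃ ^ (1 / 2 : ℝ) :=
        Real.rpow_lt_rpow h0 hlt (by norm_num)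
      rw [hη₃, ← Real.rpow_natCast, ← Real.rpow_mul (by positivity)] at h1
      norm_num at h1
      exact h1
    have hroot0 : 0 ≤ (t - tstar) ^ (1 / 2 : ℝ) := Real.rpow_nonneg h0 _
    calc C * (M ^ 2 * (2 * (t - tstar) ^ (1 / 2 : ℝ)))
        = (C * (M ^ 2 * 2)) * (t - tstar) ^ (1 / 2 : ℝ) := by ring
      _ ≤ L * (t - tstar) ^ (1 / 2 : ℝ) :=
          mul_le_mul_of_nonneg_right (by rw [hL]; linarith) hroot0
      _ < L * (ε / L) := mul_lt_mul_of_pos_left hroot hLpos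
      _ = ε := by field_simp
  -- a bad time close to `tstar`
  set η : ℝ := min (min η₁ η₂) η₃ with hη
  have hηpos : 0 < η := by rw [hη]; positivity
  obtain ⟨t, htB, htlt⟩ := exists_lt_of_csInf_lt ⟨b₀, hb₀⟩ (show sInf B < tstar + η by linarith)
  have hst : tstar ≤ t := csInf_le hBbdd htB
  have htI' : t ∈ Ioc 0 t₁ := htB.1
  have hdist : dist t tstar < η := by
    rw [Real.dist_eq, abs_of_nonneg (sub_nonneg.2 hst)]
    linarith
  have hd₁ : dist t tstar < η₁ := hdist.trans_le ((min_le_left _ _).trans (min_le_left _ _))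
  have hd₂ : dist t tstar < η₂ := hdist.trans_le ((min_le_left _ _).trans (min_le_right _ _))
  have hd₃ : t - tstar < η₃ := by
    have := hdist.trans_le (min_le_right _ _)
    rwa [Real.dist_eq, abs_of_nonneg (sub_nonneg.2 hst)] at this
  have hG1 := hG' htI' hd₁
  have hψ1 := hψ' htI' hd₂
  rw [Real.dist_eq] at hG1 hψ1
  have hG2 : G t < G tstar + ε := by linarith [(abs_lt.1 hG1).2]
  have hψ2 : ψ tstar - ε < ψ t := by linarith [(abs_lt.1 hψ1).1]
  have hfinal : V t < ψ t :=
    calc V t ≤ G t + C * (M ^ 2 * (2 * (t - tstar) ^ (1 / 2 : ℝ))) := hkey t htB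
      _ < (G tstar + ε) + ε := add_lt_add hG2 (hslack t hst hd₃)
      _ = ψ tstar - ε := by rw [hε]; ring
      _ < ψ t := hψ2
  exact absurd htB.2 (not_lt.2 hfinal.le)

end Literature.Analysis.FluidPDE

end
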